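import Literature.NumberTheory.EllipticCurves.KubertTate289CubicLocalTwo
import HarnessLib

/-!
# `E_{28/9}` over its cubic `2`-division field: the support of `(B)`

Topic `NumberTheory/EllipticCurves`. For the `φ̂`-side of the `2`-isogeny descent of `X = E_{A,B} ≅ E_K` over
`K = ℚ(γ)` (`γ³ - γ² + 27γ + 36 = 0`) the Selmer group `Ξ⁻¹(Ш(V₀/K))` (`V₀' = X`) lives in `K(S, 2)` with `S` the
set of finite places dividing `B = -152521 - 158036γ + 88849δ` (Silverman *AEC* X.4.9; tree
`TwoIsogenySelmerGroupShaNF`). Here: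

* `support_B` — **`supp (B) ⊆ {𝔮₂, 𝔭₃a, 𝔭₃b, 𝔭₇, 𝔭₂₀₆₉}`**: a finite place containing `B` is `𝔮₂ = (2, γ² + γ + 1)`,
  `𝔭₃a = (3, δ)`, `𝔭₃b = (3, δ - 1)`, `𝔭₇ = (7, γ - 1)` or `𝔭₂₀₆₉ = (2069, γ - 1278)` (numerically
  `(B) = 𝔮₂⁹𝔭₃a⁵𝔭₃b⁵𝔭₇⁵𝔭₂₀₆₉`): `|N(B)| = 2¹⁸3¹⁰7⁵·2069 ∈ v` forces `v ∣ 2, 3, 7, 2069`, and the residues `φ(B) ≠ 0`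
  exclude `𝔭₂, 𝔭₃c, 𝔮₇, 𝔮₂₀₆₉`.

Theorems only; no named facts.

## References
* [SilvermanAEC2009] J. H. Silverman, *The Arithmetic of Elliptic Curves*, 2nd ed. (2009), Prop. X.4.9, Cor. X.4.4.
* [Marcus2018] D. A. Marcus, *Number Fields*, 2nd ed. (2018), Ch. 3 Thm. 22, 27.
-/

noncomputable section

namespace Literature.NumberTheory.EllipticCurves

namespace KubertTate289Cubic

open scoped _root_.Classical _root_.NumberField
open _root_.Polynomial _root_.Module _root_.NumberField _root_.Ideal _root_.IsDedekindDomain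
open _root_.WeierstrassCurve _root_.WeierstrassCurve.Affine
open _root_.Literature.NumberTheory.NumberFields _root_.Literature.NumberTheory.NumberFields.MonicCubic
open _root_.Literature.NumberTheory.NumberFields.CubicField14483

variable {K : Type*} [Field K] [NumberField K] {γ : K}

/-- **`supp (B) ⊆ {𝔮₂, 𝔭₃a, 𝔭₃b, 𝔭₇, 𝔭₂₀₆₉}`**: a finite place containing `B = -152521 - 158036γ + 88849δ` is
`𝔮₂ = (2, γ² + γ + 1)` or one of `ker φ₃a` (`γ, δ ↦ 1, 0`), `ker φ₃b` (`0, 1`), `ker φ₇` (`γ ↦ 1`), `ker φ₂₀₆₉`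
(`γ ↦ 1278`). [cite: Marcus2018, Ch. 3, Thm. 22] -/
theorem support_B (hγ : γ ^ 3 - γ ^ 2 + 27 * γ + 36 = 0) (h3 : finrank ℚ K = 3)
    (φ₃a : 𝓞 K →+* ZMod 3) (hφ₃a : φ₃a (thetaInt (delta_root hγ)) = 0)
    (φ₃b : 𝓞 K →+* ZMod 3) (hφ₃b : φ₃b (thetaInt (delta_root hγ)) = 1)
    (φ₇ : 𝓞 K →+* ZMod 7) (hφ₇ : φ₇ (thetaInt (aeval_eq hγ)) = 1)
    (φ₂₀₆₉ : 𝓞 K →+* ZMod 2069) (hφ₂₀₆₉ : φ₂₀₆₉ (thetaInt (aeval_eq hγ)) = 1278)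
    (v : HeightOneSpectrum (𝓞 K))
    (hv : (((-152521 : ℤ) : 𝓞 K) + (-158036 : ℤ) * thetaInt (aeval_eq hγ) + (88849 : ℤ) * thetaInt (delta_root hγ)) ∈ v.asIdeal) :
    v.asIdeal = span {((2 : ℕ) : 𝓞 K),
        thetaInt (aeval_eq hγ) ^ 2 + ((1 : ℤ) : 𝓞 K) * thetaInt (aeval_eq hγ) + ((1 : ℤ) : 𝓞 K)} ∨
      v.asIdeal = RingHom.ker φ₃a ∨ v.asIdeal = RingHom.ker φ₃b ∨ v.asIdeal = RingHom.ker φ₇ ∨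
      v.asIdeal = RingHom.ker φ₂₀₆₉ := by
  -- finite facts
  have r7 : ((6 : ℤ) : ZMod 7) ^ 3 + ((-1 : ℤ) : ZMod 7) * ((6 : ℤ) : ZMod 7) ^ 2 + ((27 : ℤ) : ZMod 7) * (6 : ℤ) +
      ((36 : ℤ) : ZMod 7) = 0 := by decide
  have r2069 : ((1583 : ℤ) : ZMod 2069) ^ 3 + ((-1 : ℤ) : ZMod 2069) * ((1583 : ℤ) : ZMod 2069) ^ 2 +
      ((27 : ℤ) : ZMod 2069) * (1583 : ℤ) + ((36 : ℤ) : ZMod 2069) = 0 := by decide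
  have eB2 : ((-152521 : ℤ) : ZMod 2) + ((-158036 : ℤ) : ZMod 2) * 0 + ((88849 : ℤ) : ZMod 2) * 0 ≠ 0 := by
    decide
  have e2δ : ∀ t : ZMod 2, 3 * t = ((0 : ℤ) : ZMod 2) ^ 2 - (0 : ℤ) + 18 → t = 0 := by decide
  have eB3c : ((-152521 : ℤ) : ZMod 3) + ((-158036 : ℤ) : ZMod 3) * (1 - (2 : ℤ) ^ 2) + ((88849 : ℤ) : ZMod 3) * (2 : ℤ)
      ≠ 0 := by decide
  have e7δ : (5 : ZMod 7) * (((6 : ℤ) : ZMod 7) ^ 2 - (6 : ℤ) + 18) = 2 := by decide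
  have eB7 : ((-152521 : ℤ) : ZMod 7) + ((-158036 : ℤ) : ZMod 7) * (6 : ℤ) + ((88849 : ℤ) : ZMod 7) * 2 ≠ 0 := by decide
  have e2069δ : (690 : ZMod 2069) * (((1583 : ℤ) : ZMod 2069) ^ 2 - (1583 : ℤ) + 18) = 278 := by decide
  have eB2069 : ((-152521 : ℤ) : ZMod 2069) + ((-158036 : ℤ) : ZMod 2069) * (1583 : ℤ) +
      ((88849 : ℤ) : ZMod 2069) * 278 ≠ 0 := by decide
  haveI : Fact (Nat.Prime 7) := ⟨by norm_num⟩
  haveI : Fact (Nat.Prime 2069) := ⟨by norm_num⟩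
  set B : 𝓞 K := (((-152521 : ℤ) : 𝓞 K) + (-158036 : ℤ) * thetaInt (aeval_eq hγ) + (88849 : ℤ) * thetaInt (delta_root hγ)) with hB
  have hNabs : (Algebra.norm ℤ B).natAbs = 538273698930229248 := by rw [hB, norm_lin3 hγ h3]; norm_num
  have hNmem : ((538273698930229248 : ℕ) : 𝓞 K) ∈ v.asIdeal := by
    have h := Ideal.absNorm_mem (Ideal.span {B})
    rw [Ideal.absNorm_span_singleton, hNabs] at h
    exact (Ideal.span_singleton_le_iff_mem _).mpr hv h
  have hfac : ((538273698930229248 : ℕ) : 𝓞 K) = (2 : 𝓞 K) ^ 18 * (3 : 𝓞 K) ^ 10 * (7 : 𝓞 K) ^ 5 * 2069 := by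
    norm_num
  rw [hfac] at hNmem
  have hprime := v.isPrime
  have hcases : (2 : 𝓞 K) ∈ v.asIdeal ∨ (3 : 𝓞 K) ∈ v.asIdeal ∨ (7 : 𝓞 K) ∈ v.asIdeal ∨ (2069 : 𝓞 K) ∈ v.asIdeal := by
    rcases hprime.mem_or_mem hNmem with h | h
    · rcases hprime.mem_or_mem h with h | h
      · rcases hprime.mem_or_mem h with h | h
        · exact Or.inl (hprime.mem_of_pow_mem 18 h)
        · exact Or.inr (Or.inl (hprime.mem_of_pow_mem 10 h))
      · exact Or.inr (Or.inr (Or.inl (hprime.mem_of_pow_mem 5 h)))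
    · exact Or.inr (Or.inr (Or.inr h))
  haveI := hprime
  rcases hcases with h2 | h3' | h7 | h2069
  · -- above `2`: `𝔭₂` is excluded (`B` is odd there), `𝔮₂` remains
    have hP := mem_primesOver_of_natCast_mem (K := K) (p := 2) (by exact_mod_cast h2)
    rcases eq_span_of_mem_primesOver_two hγ h3 hP with h | h
    · exfalso
      obtain ⟨ψ₁, hψ₁⟩ := exists_psi_two hγ h3
      have hψ₁δ : ψ₁ (thetaInt (delta_root hγ)) = 0 := by
        have hh := congrArg ψ₁ (three_delta hγ)
        rw [map_mul, map_ofNat, map_add, map_sub, map_pow, map_ofNat, hψ₁] at hh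
        exact e2δ _ (by rw [hh]; simp)
      have hker : v.asIdeal = RingHom.ker ψ₁ := by
        rw [h, ker_residueHom_eq_span irreducible_polyQ (aeval_eq hγ)
          (not_dvd_exponent hγ h3 Nat.prime_two (by norm_num)) ψ₁ (r := 0) (by rw [hψ₁]; simp)]
      apply eB2
      have hm : B ∈ RingHom.ker ψ₁ := hker ▸ hv
      rw [RingHom.mem_ker, hB] at hm
      simpa only [map_add, map_mul, map_intCast, hψ₁, hψ₁δ] using hm
    · exact Or.inl h
  · -- above `3`: `𝔭₃c` excluded
    have hP := mem_primesOver_of_natCast_mem (K := K) (p := 3) (by exact_mod_cast h3')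
    obtain ⟨ψ₂, hψ₂δ, hψ₂γ⟩ := exists_residueHom_three hγ h3 2
    obtain ⟨-, hP'⟩ := eq_ker_of_mem_primesOver_three hγ h3 φ₃a φ₃b ψ₂ (by rw [hφ₃a]; simp) (by rw [hφ₃b]; simp)
      hψ₂δ hP
    rcases hP' with h | h | h
    · exact Or.inr (Or.inl h)
    · exact Or.inr (Or.inr (Or.inl h))
    · exfalso; apply eB3c
      have hm : B ∈ RingHom.ker ψ₂ := h ▸ hv
      rw [RingHom.mem_ker, hB] at hm
      simpa only [map_add, map_mul, map_intCast, hψ₂γ, hψ₂δ] using hm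
  · -- above `7`: `𝔮₇ = (7, γ - 6)` excluded
    have hP := mem_primesOver_of_natCast_mem (K := K) (p := 7) (by exact_mod_cast h7)
    obtain ⟨ψ₇, hψ₇γ, -⟩ := exists_residueHom_gamma hγ h3 (p := 7) (by norm_num) 6 r7
    have hψ₇δ : ψ₇ (thetaInt (delta_root hγ)) = 2 := by
      rw [residueHom_seven_delta hγ ψ₇ _ hψ₇γ]; exact e7δ
    obtain ⟨-, hP'⟩ := eq_ker_of_mem_primesOver_seven hγ h3 φ₇ ψ₇ (by rw [hφ₇]; simp) hψ₇γ hP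
    rcases hP' with h | h
    · exact Or.inr (Or.inr (Or.inr (Or.inl h)))
    · exfalso; apply eB7
      have hm : B ∈ RingHom.ker ψ₇ := h ▸ hv
      rw [RingHom.mem_ker, hB] at hm
      simpa only [map_add, map_mul, map_intCast, hψ₇γ, hψ₇δ] using hm
  · -- above `2069`: `𝔮₂₀₆₉ = (2069, γ - 1583)` excluded
    have hP := mem_primesOver_of_natCast_mem (K := K) (p := 2069) (by exact_mod_cast h2069)
    obtain ⟨ψ', hψ'γ, -⟩ := exists_residueHom_gamma hγ h3 (p := 2069) (by norm_num) 1583 r2069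
    have hψ'δ : ψ' (thetaInt (delta_root hγ)) = 278 := by
      rw [residueHom_2069_delta hγ ψ' _ hψ'γ]; exact e2069δ
    obtain ⟨-, hP'⟩ := eq_ker_of_mem_primesOver_2069 hγ h3 φ₂₀₆₉ ψ' (by rw [hφ₂₀₆₉]; simp) hψ'γ hP
    rcases hP' with h | h
    · exact Or.inr (Or.inr (Or.inr (Or.inr h)))
    · exfalso; apply eB2069
      have hm : B ∈ RingHom.ker ψ' := h ▸ hv
      rw [RingHom.mem_ker, hB] at hm
      simpa only [map_add, map_mul, map_intCast, hψ'γ, hψ'δ] using hm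

end KubertTate289Cubic

end Literature.NumberTheory.EllipticCurves

end
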